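import Literature.NumberTheory.NumberFields.NFIsoTestFP
import Literature.NumberTheory.NumberFields.NumberFieldIsomorphismPProofs
import Literature.Computability.Complexity.LengthCompare
import Literature.Computability.Complexity.IrreducibilityLLLDecideFP
import HarnessLib

/-!
# Number-field isomorphism is in `P`: the language-level assembly (Landau 1985; Lenstra 1983)

Support file for the discharge of the named fact
`Literature.NumberTheory.NumberFields.nfIso_mem_P` (number-field isomorphism is in `P`;
Landau 1985, Thm. 2.1 and Cor.; A. K. Lenstra 1983, Thm. (3.7); H. W. Lenstra 1992, §2.9). The
decision procedure `nfIsoTest` (`NFIsoTest.lean`, proved correct there: `nfIsoTest_eq_true_iff`)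
works on integer coefficient lists; the languages of the two named facts
(`Literature.Computability.Complexity.lenstra_numberFieldIso_mem_P`: `NFIsoLang`, decode-based;
`nfIso_mem_P`: `nfIsoLang`, exact codes — equivalent by `nfIso_mem_P_iff`,
`NumberFieldIsomorphismPEquiv.lean`) are sets of BIT STRINGS. This file closes the gap:

* the decider on strings — check that `w` is a pair code `⟨u, v⟩`, decode both components with the
  total decoder `decIntList` (`NumberFieldIsomorphismPProofs.lean`: `polyDecode u = some (decPoly u)`,
  `decPoly u = ofCoeffs (decIntList u)`), and run `nfIsoTest` — is correct: `mem_NFIsoLang_iff`;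
* `decIntListC` — the decoder on codes (the tree's canonicalisation
  `CanonCode.canonListFn canonIntFn = encode ∘ decode ∈ FP`), `nfIsoDecideC_of`;
* **`lenstra_numberFieldIso_mem_P_of_nfIsoTestC`** / **`nfIso_mem_P_of_nfIsoTestC`**: a
  `CodeFP` realisation of `nfIsoTest` puts `NFIsoLang`, hence `nfIsoLang`, in `P`
  (`mem_P_of_mem_FP`); with `nfIsoTestC_of` (`NFIsoTestFP.lean`) this reduces both named facts to
  the two bricks `irredTest`/`firstRowSqNorm` on codes of the tree's `lll_monicIrreducible_mem_P`
  development (`nfIso_mem_P_of_bricks`), which `IrreducibilityLLLDecideFP.lean` supplies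
  (`irredTestRawC`, `firstRowSqNormC`): **`nfIsoTestC`**, **`nfIso_mem_P_holds : nfIso_mem_P`** — the
  DISCHARGE of the named fact — and, for the record, the decode-based form
  `lenstra_numberFieldIso_mem_P` (`NFIsoLang ∈ P`) as `nfIsoLangDecoded_mem_P`.

## References

* S. Landau, *Factoring polynomials over algebraic number fields*, SIAM J. Comput. 14 (1985)
  184–195, §2 (Thm. 2.1 and Cor.). [Landau1985]
* A. K. Lenstra, *Factoring polynomials over algebraic number fields*, LNCS 162 (1983), Thm. (3.7). [Lenstra1983]
* H. W. Lenstra Jr., *Algorithms in algebraic number theory*, Bull. AMS 26 (1992), §2.9. [Lenstra1992]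
* S. Arora, B. Barak, *Computational Complexity: A Modern Approach*, CUP 2009, Def. 1.13, §1.3. [AroraBarak2009]
-/

open Polynomial

namespace Literature.NumberTheory.NumberFields

open Literature.Computability.Complexity Literature.Computability.Complexity.CodeFP
open Literature.Computability.Complexity.SumcheckMA Literature.Computability.Complexity.LLLFactoring
open _root_.Computability Brick

/-- The encoder of coefficient lists. -/
local notation "L" => rawE intE

/-! ### The decider on strings -/

/-- The two readings of an integer list as a polynomial agree: `ofCoeffsAsc = ofCoeffs`. [folklore] -/
theorem ofCoeffsAsc_eq_ofCoeffs (l : List ℤ) : ofCoeffsAsc l = ofCoeffs l := by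
  ext i
  rw [coeff_ofCoeffsAsc, coeff_ofCoeffs]

/-- The polynomial decoded from any string is `ofCoeffs` of the decoded integer list. [folklore] -/
theorem decPoly_eq_ofCoeffs (w : List Bool) : decPoly w = ofCoeffs (decIntList w) :=
  ofCoeffsAsc_eq_ofCoeffs _

/-- **The decider of `NFIsoLang` on strings** — a genuine pair code `w = ⟨u, v⟩` whose two decoded
integer lists pass `nfIsoTest` — **is correct.** [cite: Landau1985, §2 (Cor.)] [cite: Lenstra1983, Thm. 3.7] [cite: AroraBarak2009, Def. 1.13] -/
theorem mem_NFIsoLang_iff (w : List Bool) :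
    w ∈ NFIsoLang ↔
      (decide (w = boolPair (fstF w) (sndF w)) && nfIsoTest (decIntList (fstF w)) (decIntList (sndF w))) = true := by
  rw [Bool.and_eq_true, decide_eq_true_iff, nfIsoTest_eq_true_iff]
  constructor
  · rintro ⟨u, v, p, q, rfl, hu, hv, hpm, hpi, hqm, hqi, hiso⟩
    rw [fstF_boolPair, sndF_boolPair]
    rw [eq_decPoly_of_polyDecode_eq hu, decPoly_eq_ofCoeffs] at hpm hpi hiso
    rw [eq_decPoly_of_polyDecode_eq hv, decPoly_eq_ofCoeffs] at hqm hqi hiso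
    exact ⟨rfl, ⟨hpm, hpi⟩, ⟨hqm, hqi⟩, hiso⟩
  · rintro ⟨hw, ⟨hpm, hpi⟩, ⟨hqm, hqi⟩, hiso⟩
    refine ⟨fstF w, sndF w, ofCoeffs (decIntList (fstF w)), ofCoeffs (decIntList (sndF w)), hw, ?_, ?_,
      hpm, hpi, hqm, hqi, hiso⟩
    · rw [polyDecode_eq_some, decPoly_eq_ofCoeffs]
    · rw [polyDecode_eq_some, decPoly_eq_ofCoeffs]

/-! ### The decider on codes -/

/-- **The total integer-list decoder on codes**: the tree's canonicalisation
`canonListFn canonIntFn = encode ∘ decode ∈ FP`, followed by dropping the length header and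
converting the items to canonical integer codes. [cite: AroraBarak2009, §0.1 and §1.3] -/
theorem decIntListC : CodeFP strE L decIntList := by
  have h1 : CodeFP strE (listE smE) decIntList :=
    of_fn (CanonCode.canonListFn CanonCode.canonIntFn)
      (CanonCode.canonListFn_mem_FP CanonCode.canonIntFn_mem_FP CanonCode.length_canonIntFn_le) fun w => by
        rw [show strE w = w from rfl, canonListFn_canonIntFn_eq, listE_eq]
        rfl
  have h2 : CodeFP (listE smE) L (fun l => l.map id) := ((map₀ intOfSM).comp (rawOfList smE) :)
  exact (h2.comp h1).congr fun w => List.map_id _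

/-- `fstF` on codes. [folklore] -/
theorem fstFC : CodeFP strE strE fstF := of_fn fstF fstF_mem_FP fun _ => rfl

/-- `sndF` on codes. [folklore] -/
theorem sndFC : CodeFP strE strE sndF := of_fn sndF sndF_mem_FP fun _ => rfl

/-- **The decider on codes**, given `nfIsoTest` on codes. [cite: AroraBarak2009, §1.3] -/
theorem nfIsoDecideC_of (h : CodeFP (pairE L L) bitE (fun t => nfIsoTest t.1 t.2)) :
    CodeFP strE bitE (fun w => decide (w = boolPair (fstF w) (sndF w)) &&
      nfIsoTest (decIntList (fstF w)) (decIntList (sndF w))) := by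
  have hpair : CodeFP strE strE (fun w => boolPair (fstF w) (sndF w)) := (fstFC.pair sndFC).recodeOut fun _ => rfl
  have heq : CodeFP strE bitE (fun w => decide (w = boolPair (fstF w) (sndF w))) :=
    ((CodeFP.eq (eα := strE) fun a b hab => hab).comp ((CodeFP.id _).pair hpair) :)
  have htest : CodeFP strE bitE (fun w => nfIsoTest (decIntList (fstF w)) (decIntList (sndF w))) :=
    (h.comp ((decIntListC.comp fstFC).pair (decIntListC.comp sndFC)) :)
  exact (heq.and htest).congr fun _ => rfl

/-! ### The languages are in `P` -/

/-- **`NFIsoLang ∈ P` from `nfIsoTest` on codes** (the decode-based fact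
`lenstra_numberFieldIso_mem_P` of `NumberFieldIsomorphism.lean`). [cite: Lenstra1983, Thm. 3.7] [cite: Landau1985, §2 (Cor.)] [cite: AroraBarak2009, Def. 1.13] -/
theorem lenstra_numberFieldIso_mem_P_of_nfIsoTestC (h : CodeFP (pairE L L) bitE (fun t => nfIsoTest t.1 t.2)) :
    lenstra_numberFieldIso_mem_P := by
  obtain ⟨F, hF, hFw⟩ := nfIsoDecideC_of h
  refine mem_P_of_mem_FP hF _ fun w => ⟨fun hw => ?_, fun hw => ?_⟩
  · have h1 := hFw w
    dsimp only at h1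
    rw [(mem_NFIsoLang_iff w).1 hw] at h1
    exact h1
  · have h0 : (decide (w = boolPair (fstF w) (sndF w)) &&
        nfIsoTest (decIntList (fstF w)) (decIntList (sndF w))) = false := by
      rw [← Bool.not_eq_true]
      exact fun h' => hw ((mem_NFIsoLang_iff w).2 h')
    have h1 := hFw w
    dsimp only at h1
    rw [h0] at h1
    exact h1

/-- **`nfIso_mem_P` from `nfIsoTest` on codes** (through `nfIso_mem_P_of_lenstra_numberFieldIso_mem_P`,
`NumberFieldIsomorphismPProofs.lean`). [cite: Landau1985, §2 (Cor.)] [cite: Lenstra1983, Thm. 3.7] [cite: Lenstra1992, §2.9] -/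
theorem nfIso_mem_P_of_nfIsoTestC (h : CodeFP (pairE L L) bitE (fun t => nfIsoTest t.1 t.2)) : nfIso_mem_P :=
  nfIso_mem_P_of_lenstra_numberFieldIso_mem_P (lenstra_numberFieldIso_mem_P_of_nfIsoTestC h)

/-- **`nfIso_mem_P` from the two remaining bricks** of the tree's `lll_monicIrreducible_mem_P`
development: the irreducibility test `irredTest` and the first-row norm `firstRowSqNorm` of the
LLL-reduced factor lattice on codes. [cite: Landau1985, §2 (Cor.)] [cite: Lenstra1983, Thm. 3.7] [cite: LenstraLenstraLovasz1982, §3] -/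
theorem nfIso_mem_P_of_bricks (hIrr : CodeFP L bitE irredTest)
    (hFR : CodeFP (pairE (pairE unE unE) (pairE L natE)) intE (fun t => firstRowSqNorm t.1.1 t.1.2 t.2.1 t.2.2)) :
    nfIso_mem_P :=
  nfIso_mem_P_of_nfIsoTestC (nfIsoTestC_of hIrr hFR)

/-! ### The discharge -/

/-- The tree's first-row brick `firstRowSqNormC` (`(n, (d, (U, m)))`) in the argument order used here
(`((n, d), (U, m))`). [cite: LenstraLenstraLovasz1982, (3.4)–(3.5)] -/
theorem firstRowSqNormC' :
    CodeFP (pairE (pairE unE unE) (pairE L natE)) intE (fun t => firstRowSqNorm t.1.1 t.1.2 t.2.1 t.2.2) :=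
  (firstRowSqNormC.comp ((fst _ _).fst'.pair ((fst _ _).snd'.pair (snd _ _)))).congr fun _ => rfl

/-- **The isomorphism test for number fields is computed on codes by a polynomial-time string
function** (all bricks from the tree). [cite: Landau1985, §2 (Cor.)] [cite: Lenstra1983, Thm. 3.7] [cite: AroraBarak2009, §1.3] -/
theorem nfIsoTestC : CodeFP (pairE L L) bitE (fun t => nfIsoTest t.1 t.2) :=
  nfIsoTestC_of irredTestRawC firstRowSqNormC'

/-- **`NFIsoLang ∈ P`** (the decode-based language of `NumberFieldIsomorphism.lean`; this is the
statement of the named fact `Literature.Computability.Complexity.lenstra_numberFieldIso_mem_P`).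
[cite: Lenstra1983, Thm. 3.7] [cite: Landau1985, §2 (Cor.)] -/
theorem nfIsoLangDecoded_mem_P : NFIsoLang ∈ Classes.P :=
  lenstra_numberFieldIso_mem_P_of_nfIsoTestC nfIsoTestC

/-- **Discharge of the named fact `nfIso_mem_P`: number-field isomorphism is in `P`.** The language
`nfIsoLang` of pair codes `⟨p, q⟩` of monic irreducible integer polynomials with
`ℚ[X]/(p) ≃ₐ[ℚ] ℚ[X]/(q)` is decided in deterministic polynomial time (Mathlib's `TM2` model) by the
machine assembled in this development: parsing and the LLL irreducibility test (LLL 1982 §3, tree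
`IrreducibilityLLL*.lean`), the degree check, Trager's norm `N_c = Res_Y(q(Y), p(X − cY))` by integer
resultants and exact interpolation (Landau 1985 Thm. 1.4, Cohen Alg. 3.6.4), the search for a
multiplier with squarefree norm (Landau Thm. 1.5, Cohen Lemma 3.6.2), and the LLL degree test for an
irreducible factor of degree `≤ deg q` (LLL 1982 Prop. (2.13); A. K. Lenstra 1983 Thm. (3.7); Cohen
Prop. 4.5.3 / Alg. 4.5.4–4.5.6), proved correct in `NFIsoTest.nfIsoTest_eq_true_iff`.
[cite: Landau1985, main theorem p. 184 and §2 (Thm. 2.1, Cor.)] [cite: Lenstra1983, Thm. (3.7)] [cite: Lenstra1992, §2.9] -/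
theorem nfIso_mem_P_holds : nfIso_mem_P :=
  nfIso_mem_P_of_nfIsoTestC nfIsoTestC

end Literature.NumberTheory.NumberFields
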